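import Mathlib
import Literature.AlgebraicGeometry.Resolution.ReAdaptation
import Literature.AlgebraicGeometry.Resolution.HironakaDirectrixIdeal
import Literature.AlgebraicGeometry.Resolution.CutkoskySurfaceOmegaSequence
import HarnessLib

/-!
# Cutkosky 2009, Lemma 10.1: `z = 0` is an approximate manifold iff the corner vertices
# `(1,0)`, `(0,1)` are prepared — and the dictionary `τ(I) = 1` / good parameters ↔ the tree

Topic: `Literature/AlgebraicGeometry/Resolution`.  S. D. Cutkosky, *Resolution of singularities
for 3-folds in positive characteristic*, Amer. J. Math. **131** (2009) 59–127 [cite: Cutkosky2009]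
(held copy `paper:doi-10-1353-ajm-0-0036`, file page = printed page), §10.2 p. 29 l. 5–40:

> "We will say that the vertex `(a, b)` is not prepared on `|Δ|` if `a, b` are integers and there
> exists `η ∈ k` such that `{g}^{ab}_{xyz} = b_{00r}(g)(z − η x^a y^b)^r` for every `g ∈ I` with
> `ν_T(g) = r`.  We will say that the vertex `(a, b)` is prepared on `|Δ|` if such an `η` does not
> exist. […]
> **Lemma 10.1.** Suppose that `ν_T(I) = r`, `τ(I) = 1`, and `(x, y, z)` are good parameters of
> `I`.  Then `z = 0` is an approximate manifold of `I` if and only if the vertices `(0, 1)` and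
> `(1, 0)` are prepared on `|Δ(I; x, y, z)|`.
> *Proof.* Suppose that `(0,1)` and `(1,0)` are prepared […]. Since `τ(I) = 1`, there is a linear
> form `ax + by + cz` […] such that `V(ax + by + cz)` is an approximate manifold of `I`.  For each
> `g ∈ I` with `ν_T(g) = r`, there exists `0 ≠ d_g ∈ k` such that the `r`-leading form of `g` is
> `d_g(ax + by + cz)^r`.  As `(x, y, z)` are good parameters for `I`, `b_{00r}(g) ≠ 0`, so we must
> have `c ≠ 0`.  If `a ≠ 0`, then `(1, 0)` is a vertex of `|Δ(I; x, y, z)|`, which is not prepared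
> since […] `{g}^{(1,0)}_{xyz} = d_g c^r (z + (a/c) x)^r`.  Thus `a = 0`.  If `b ≠ 0`, then `(0,1)` is
> a vertex […] which is not prepared […].  Thus `a = b = 0` and `z = 0` is an approximate manifold
> of `I`.  The proof of the converse also follows from the above arguments."

with §5 p. 17 l. 32–43 ("The `r`-leading form `L` of `f` […]. Define `τ(p)` to be the dimension of
the smallest linear subspace `T` […] such that `L ∈ k[T]` for all `f ∈ I_p` […]. We will call the
subvariety `M_p = V(T)` of `Spec(𝒪_{V,p})` an approximate manifold to `I` at `p`"), §10.2 p. 28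
l. 65–66 ("`(x, y, z)` will be called good parameters for `I` if `ν_T(I) = r` and `b_{00r} ≠ 0` for
all `g ∈ I` such that `ν_T(g) = r`.  Good parameters exist if `τ(I) = 1`"), and its first use,
Theorem 10.17, p. 34 l. 42–46: "Lemma 10.1 implies `z = 0` is an approximate manifold of `I`.  Thus
since `τ(I) = 1`, (20) `α + β > 1`."

## Dictionary (Cutkosky ↔ the tree's expansion-free vocabulary), all PROVED here

The tree (Cossart–Jannsen–Saito / Cossart–Piltant files) works in a regular local ring `R` of
dimension `3` with a regular system of parameters `c = (c 0, c 1, c 2) = (y, u₁, u₂)`; Cutkosky's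
`T = k⟦x, y, z⟧` with `(z, x, y) ↔ (c 0, c 1, c 2)` (the dictionary of `CutkoskySurfaceOmega*.lean`).
The `r`-leading form of `g` is the tree's `𝔪`-adic initial form `inForm c (fun _ ↦ 1) r g`
(`WeightedInitialForms`), the set of leading forms of `I` is `initialForms c I r` (`HironakaDirectrix`):

* `τ(I) = 1` — Cutkosky's expansion-free rendering `Cutkosky2009.TauOne I r` of
  `CutkoskySurfaceOmegaSequence.lean` (`I ⊆ (ℓ^r) + 𝔪^{r+1}`, `ℓ ∈ 𝔪 ∖ 𝔪²`) versus the tree's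
  `hironakaTauAt c I r = 1` (dimension of the directrix of `cl_r(I)`):
  `hironakaTauAt_eq_one_of_tauOne`, `tauOne_of_hironakaTauAt_eq_one` (for `I` of order exactly `r ≥ 1`);
* good parameters — `Cutkosky2009.IsGood c I r` (every `g ∈ I` of order `r` has a `z^r` term)
  implies the tree's `HasMonic c I r` (`ReAdaptation.lean`: some leading form has a `Y^r` term):
  `hasMonic_of_isGood`;
* "`z = 0` is an approximate manifold of `I`" (all `r`-leading forms lie in `k[Z]`, i.e. are scalar
  multiples of `Z^r`) is the tree's shape `LinShape c I r 0 0`, equivalently `I ⊆ (z^r) + 𝔪^{r+1}`: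
  `linShape_zero_zero_iff_le_span_pow_sup`;
* "`(1, 0)` is prepared" / "`(0, 1)` is prepared": for these two CORNER vertices of the face
  `S(1)` the partial leading form `{g}^{(1,0)}_{xyz}` (the monomials `x^i z^k`, `i + k = r`) is the
  tree's initial form along the TILTED weight `(L, L, 2L)` in degree `L r` (`IsInForm.tilt_two`: the
  `X₂`-free part of the `𝔪`-adic initial form), so "`(1,0)` not prepared, with `η`" is EXACTLY
  `IsSolvableAt c I (levelWeight r r! 1 2) (r!·r) r (vexp 1 0) (−η)` of `WeightedInitialForms`
  (Cossart–Piltant's solvable vertex), and "`(1,0)` is prepared" is typed INLINE as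
  `∀ η ≠ 0, ¬ IsSolvableAt c I (levelWeight r r! 1 2) (r!·r) r (vexp 1 0) η` (resp. weight
  `levelWeight r r! 2 1` and `vexp 0 1` for `(0,1)`) — "not solvable for any `λ ≠ 0`" (Cutkosky's `η`
  is necessarily `≠ 0` at a vertex, p. 28 observation 1 "The vertices of `|Δ|` are points of `Δ`";
  `λ = 0` would only say that `(1,0) ∉ Δ`, in which case "prepared" is vacuous).  No new definition is
  introduced (the tree's `IsSolvableAt`, `LinShape`, `HasMonic`, `hironakaTauAt`, `linForm` are reused).

## What is proved (sorry-free; theorems only — no definition, no named fact, no instance)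

* `linShape_zero_zero_of_preparedCorners` — **Lemma 10.1 (⇐)**: `τ = 1`, a monic leading form
  (good parameters) and both corners prepared ⇒ all leading forms are multiples of `Z^r`;
* `preparedCornerX_of_linShape_zero_zero`, `preparedCornerY_of_linShape_zero_zero` — **Lemma 10.1 (⇒)**;
* `factorial_lt_deltaS_of_preparedCorners` — hence the polygon is ADAPTED, `δ > 1` (scaled:
  `r! < deltaS`), and `factorial_lt_alphaS_add_betaS_of_preparedCorners` — **eq. (20) `α + β > 1`**
  of the proof of Theorem 10.17;
* `le_span_pow_sup_iff_preparedCorners`, `factorial_lt_alphaS_add_betaS_of_isGood` — Lemma 10.1 and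
  eq. (20) restated over the hypotheses `Cutkosky2009.IsGood` / `Cutkosky2009.TauOne` of the named fact
  `Cutkosky2009_Thm10_18`;
* `isGood_iff_forall_coeff_ne_zero` — good parameters AS PRINTED ("`b_{00r}(g) ≠ 0` for all `g ∈ I` with
  `ν_T(g) = r`", the `Z^r`-coefficient of the leading form), via `not_mem_span_sup_of_coeff_ne_zero` /
  `mem_span_sup_of_coeff_eq_zero`; `isGood_of_linShape`, `isGood_of_hasMonic`, `isGood_iff_hasMonic`
  ("Good parameters exist if `τ(I) = 1`": under `τ = 1`, good ⟺ one monic leading form);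
* the dictionary theorems listed above (and `linShape_zero_zero_iff_factorial_lt_deltaS`: approximate
  manifold `z = 0` ⟺ `δ > 1`), with the small `IsInForm` bookkeeping they need.

Part of the discharge programme of the named fact `Cutkosky2009_Thm10_18`
(`CutkoskySurfaceOmegaSequence.lean`; F-63 of the res-hironaka FACT-LIST): it connects that fact's
typed hypotheses to the standing hypotheses `hironakaTauAt c J μ = 1`, `HasMonic`, `μ! < deltaS`
of the tree's polygon-transport theorems (`PointStepPrepared`, `CurveStepPrepared`,
`PointBlowupPolygonLaws`, `ReAdaptation.exists_readapt`).  AI-written; weaker than expert review.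

## Sources

* S. D. Cutkosky, Amer. J. Math. 131 (2009): §5 p. 17 l. 32–43; §10.2 p. 28 l. 65–66, p. 29
  l. 5–40 (Lemma 10.1); Thm. 10.17 proof p. 34 l. 42–46 (eq. (20)). [Cutkosky2009]
* V. Cossart, U. Jannsen, S. Saito, LNM 2270 (2020), Def. 8.2, Def. 8.11, Lemma 11.4. [CossartJannsenSaito2020]
* V. Cossart, O. Piltant, J. Algebra 320 (2008), §4 p. 11 (solvable vertices; `T_x = k(x)·Y`). [CossartPiltant2008]
-/

noncomputable section

open IsLocalRing MvPolynomial
open Literature.RingTheory.MvPolynomial (linForm linForm_apply)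

namespace Literature.AlgebraicGeometry.Resolution.Cutkosky2009

universe u

/-! ## `IsInForm` bookkeeping (weight `(1,1,1)`: the `𝔪`-adic leading forms) -/
section Bookkeeping

variable {R : Type u} [CommRing R] [IsLocalRing R] (c : Fin 3 → R)

/-- An element of `F_{n+1}` has initial form `0` in degree `n`. [cite: CossartJannsenSaito2020, Lemma 8.3] -/
theorem isInForm_zero_of_mem_succ {w : Fin 3 → ℕ} {n : ℕ} {m : R}
    (hm : m ∈ weightedIdealW c w (n + 1)) : IsInForm c w n m 0 :=
  ⟨0, isWeightedHomogeneous_zero _ _ _, by rw [map_zero], by rwa [map_zero, sub_zero]⟩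

/-- An element with initial form `0` in degree `n` lies in `F_{n+1}` (positive weights, `(c) = 𝔪`).
[cite: CossartJannsenSaito2020, Lemma 8.3] -/
theorem mem_succ_of_isInForm_zero (hgen : Ideal.span (Set.range c) = maximalIdeal R)
    {w : Fin 3 → ℕ} (hw : ∀ i, 0 < w i) {n : ℕ} {f : R} (h : IsInForm c w n f 0) :
    f ∈ weightedIdealW c w (n + 1) := by
  obtain ⟨F, hF, hF0, hrem⟩ := h
  have hc : ∀ m, F.coeff m ∈ maximalIdeal R := (map_residue_eq_zero_iff F).mp hF0
  have hev := eval_mem_succ_of_coeff_mem c hgen hw hF hc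
  have : f = (f - eval c F) + eval c F := by ring
  rw [this]
  exact Ideal.add_mem _ hrem hev

/-- `in_0(1) = 1`. [cite: CossartJannsenSaito2020, Lemma 8.3] -/
theorem isInForm_one (w : Fin 3 → ℕ) : IsInForm c w 0 (1 : R) 1 :=
  ⟨1, isWeightedHomogeneous_one _ _, by rw [map_one], by rw [map_one, sub_self]; exact Ideal.zero_mem _⟩

/-- Powers: `in_{k n}(f^k) = in_n(f)^k`. [cite: CossartJannsenSaito2020, Lemma 8.3] -/
theorem isInForm_pow {w : Fin 3 → ℕ} {n : ℕ} {f : R} {P : MvPolynomial (Fin 3) (ResidueField R)}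
    (h : IsInForm c w n f P) (k : ℕ) : IsInForm c w (k * n) (f ^ k) (P ^ k) := by
  induction k with
  | zero => simpa using isInForm_one c w
  | succ k ih =>
    have := IsInForm.mul c ih h
    rw [pow_succ, pow_succ]
    convert this using 2
    ring

/-- Differences: `in_n(f − g) = in_n(f) − in_n(g)` (same degree). [cite: CossartJannsenSaito2020, Lemma 8.3] -/
theorem isInForm_sub {w : Fin 3 → ℕ} {n : ℕ} {f g : R} {P Q : MvPolynomial (Fin 3) (ResidueField R)}
    (hP : IsInForm c w n f P) (hQ : IsInForm c w n g Q) : IsInForm c w n (f - g) (P - Q) := by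
  obtain ⟨F, hF, rfl, hFrem⟩ := hP
  obtain ⟨G, hG, rfl, hGrem⟩ := hQ
  have hG' : (-G).IsWeightedHomogeneous w n := fun d hd => hG (by rwa [coeff_neg, neg_ne_zero] at hd)
  refine ⟨F - G, by rw [sub_eq_add_neg]; exact hF.add hG', by rw [map_sub], ?_⟩
  have : f - g - eval c (F - G) = (f - eval c F) - (g - eval c G) := by rw [map_sub]; ring
  rw [this]; exact Ideal.sub_mem _ hFrem hGrem

omit [IsLocalRing R] in
/-- `a · Xᵢ` is homogeneous of weight `1` for the weight `(1,1,1)`. [folklore] -/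
private theorem isWeightedHomogeneous_C_mul_X {S : Type*} [CommSemiring S] (a : S) (i : Fin 3) :
    (C a * X i : MvPolynomial (Fin 3) S).IsWeightedHomogeneous (fun _ => (1 : ℕ)) 1 := by
  intro d hd
  classical
  rw [coeff_C_mul, coeff_X] at hd
  by_cases h : Finsupp.single i 1 = d
  · subst h
    rw [Finsupp.weight_apply, Finsupp.sum_single_index] <;> simp
  · rw [if_neg h, mul_zero] at hd; exact absurd rfl hd

/-- The leading form of a linear combination `Σ uᵢ cᵢ` in degree `1` is `Σ ūᵢ Xᵢ` (`gr_𝔪(R) = k[Y, U₁, U₂]`).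
[cite: CossartJannsenSaito2020, Def. 8.2] -/
theorem isInForm_linear (u : Fin 3 → R) :
    IsInForm c (fun _ => 1) 1 (u 0 * c 0 + u 1 * c 1 + u 2 * c 2)
      (C (residue R (u 0)) * X 0 + C (residue R (u 1)) * X 1 + C (residue R (u 2)) * X 2) := by
  refine ⟨C (u 0) * X 0 + C (u 1) * X 1 + C (u 2) * X 2, ?_, ?_, ?_⟩
  · exact ((isWeightedHomogeneous_C_mul_X _ _).add (isWeightedHomogeneous_C_mul_X _ _)).add
      (isWeightedHomogeneous_C_mul_X _ _)
  · simp only [map_add, map_mul, map_C, map_X]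
  · have : eval c (C (u 0) * X 0 + C (u 1) * X 1 + C (u 2) * X 2) = u 0 * c 0 + u 1 * c 1 + u 2 * c 2 := by
      simp only [map_add, map_mul, eval_C, eval_X]
    rw [this, sub_self]; exact Ideal.zero_mem _

/-- The leading form of `z^r = (c 0)^r` is `Z^r`. [cite: CossartJannsenSaito2020, Def. 8.2, Lemma 8.3] -/
theorem isInForm_pow_zero (μ : ℕ) :
    IsInForm c (fun _ => 1) μ (c 0 ^ μ) (X 0 ^ μ) := by
  have h := isInForm_linear c ![1, 0, 0]
  have e1 : (![1, 0, 0] : Fin 3 → R) 0 * c 0 + (![1, 0, 0] : Fin 3 → R) 1 * c 1 +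
      (![1, 0, 0] : Fin 3 → R) 2 * c 2 = c 0 := by simp
  have e2 : (C (residue R ((![1, 0, 0] : Fin 3 → R) 0)) * X 0 + C (residue R ((![1, 0, 0] : Fin 3 → R) 1)) * X 1 +
      C (residue R ((![1, 0, 0] : Fin 3 → R) 2)) * X 2 : MvPolynomial (Fin 3) (ResidueField R)) = X 0 := by
    simp
  rw [e1, e2] at h
  simpa using isInForm_pow c h μ

/-- The shape `(X₀ + 0·X₁ + 0·X₂)^r` is `X₀^r`. [folklore] -/
private theorem linShape_poly_zero_zero (a : ResidueField R) (μ : ℕ) :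
    (C a * (X 0 + C 0 * X 1 + C 0 * X 2) ^ μ : MvPolynomial (Fin 3) (ResidueField R)) = C a * X 0 ^ μ := by
  rw [C_0, zero_mul, zero_mul, add_zero, add_zero]

end Bookkeeping


/-! ## `τ(I) = 1`: Cutkosky's `TauOne` ↔ the tree's `hironakaTauAt = 1` -/
section Tau

variable {R : Type u} [CommRing R] [IsRegularLocalRing R] (c : Fin 3 → R)
  (hgen : Ideal.span {c 0, c 1, c 2} = maximalIdeal R) (hdim : ringKrullDim R = 3)
  {J : Ideal R} {μ : ℕ}

/-- The linear form `l₀ Z + l₁ X + l₂ Y` over the residue field, written with the tree's `linForm`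
(Cutkosky's `cz + ax + by` in the variable order `(X 0, X 1, X 2) = (Z, X, Y)`). [folklore] -/
private theorem linForm_three {k : Type u} [Field k] (l : Fin 3 → k) :
    linForm l = C (l 0) * X 0 + C (l 1) * X 1 + C (l 2) * X 2 := by
  rw [linForm_apply, Fin.sum_univ_three, smul_eq_C_mul, smul_eq_C_mul, smul_eq_C_mul]

/-- The functional `Σ lᵢ e_i^*` takes the value `lᵢ` on `e_i`. [folklore] -/
private theorem sum_smul_proj_single {k : Type u} [Field k] (l : Fin 3 → k) (i : Fin 3) :
    (∑ j, l j • (LinearMap.proj j : Module.Dual k (Fin 3 → k))) (Pi.single i 1) = l i := by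
  rw [LinearMap.sum_apply, Finset.sum_eq_single i]
  · simp
  · intro j _ hji; simp [hji]
  · exact fun h => (h (Finset.mem_univ i)).elim

/-- `linForm l` is the tree's `linearFormPoly` of the functional `Σ lᵢ e_i^*`. [folklore] -/
private theorem linearFormPoly_sum_smul_proj {k : Type u} [Field k] (l : Fin 3 → k) :
    linearFormPoly k (∑ i, l i • (LinearMap.proj i : Module.Dual k (Fin 3 → k))) = linForm l := by
  rw [linearFormPoly_eq_linForm]
  congr 1
  funext i
  exact sum_smul_proj_single l i

omit [IsRegularLocalRing R] in
/-- Each parameter lies in `𝔪`. [folklore] -/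
private theorem param_mem_maximalIdeal [IsLocalRing R] (hgen : Ideal.span {c 0, c 1, c 2} = maximalIdeal R)
    (i : Fin 3) : c i ∈ maximalIdeal R := by
  rw [← hgen]
  refine Ideal.subset_span ?_
  fin_cases i <;> simp

omit [IsRegularLocalRing R] in
/-- An element of `𝔪 = (c 0, c 1, c 2)` is a linear combination of the parameters. [folklore] -/
private theorem exists_eq_linear_of_mem [IsLocalRing R] (hgen : Ideal.span {c 0, c 1, c 2} = maximalIdeal R)
    {ℓ : R} (hℓ : ℓ ∈ maximalIdeal R) : ∃ u : Fin 3 → R, ℓ = u 0 * c 0 + u 1 * c 1 + u 2 * c 2 := by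
  rw [← hgen, Ideal.mem_span_insert] at hℓ
  obtain ⟨a, z, hz, rfl⟩ := hℓ
  obtain ⟨b, d, rfl⟩ := Ideal.mem_span_pair.mp hz
  exact ⟨![a, b, d], by simp; ring⟩

include hgen hdim in
/-- **`τ(I) = 1` in Cutkosky's form gives the shape of all leading forms**: if
`I ⊆ (ℓ^r) + 𝔪^{r+1}` with `ℓ ∈ 𝔪 ∖ 𝔪²`, then every `r`-leading form `in_r(g)`, `g ∈ I`, is
`d_g · ℓ̄^r` for the NONZERO linear form `ℓ̄ = in_1(ℓ)` ("there exists `0 ≠ d_g ∈ k` such that the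
`r`-leading form of `g` is `d_g(ax + by + cz)^r`" — `d_g = 0` exactly when `ν_T(g) > r`).
[cite: Cutkosky2009, §10.2 p. 29 l. 20–23; §5 p. 17 l. 32–43] -/
theorem exists_shape_of_tauOne (hτ : TauOne J μ) :
    ∃ l : Fin 3 → ResidueField R, l ≠ 0 ∧
      ∀ g ∈ J, ∃ a : ResidueField R, inForm c (fun _ => 1) μ g = C a * linForm l ^ μ := by
  have hgenr := span_range_eq_of_span_triple c hgen
  have h1 : ∀ i, 0 < (fun _ : Fin 3 => (1 : ℕ)) i := fun _ => Nat.one_pos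
  obtain ⟨ℓ, hℓm, hℓm2, hJ⟩ := hτ
  obtain ⟨u, hu⟩ := exists_eq_linear_of_mem c hgen hℓm
  have hin1 := isInForm_linear c u
  rw [← hu] at hin1
  set l : Fin 3 → ResidueField R := fun i => residue R (u i) with hl
  have hP : C (residue R (u 0)) * X 0 + C (residue R (u 1)) * X 1 + C (residue R (u 2)) * X 2 =
      linForm l := (linForm_three l).symm
  rw [hP] at hin1
  refine ⟨l, ?_, ?_⟩
  · -- `ℓ ∉ 𝔪²` forces a unit coefficient
    intro hl0
    apply hℓm2
    have h0 : linForm l = 0 := by rw [hl0, map_zero]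
    rw [h0] at hin1
    have := mem_succ_of_isInForm_zero c hgenr h1 hin1
    rwa [weightedIdealW_one_eq_pow c hgenr] at this
  · intro g hg
    obtain ⟨y, hy, z, hz, hyz⟩ := Submodule.mem_sup.mp (hJ hg)
    obtain ⟨a, rfl⟩ := Ideal.mem_span_singleton'.mp hy
    have hpow : IsInForm c (fun _ => 1) μ (ℓ ^ μ) (linForm l ^ μ) := by
      simpa using isInForm_pow c hin1 μ
    have hy' := IsInForm.smul c hpow a
    have hz' : IsInForm c (fun _ => 1) μ z 0 :=
      isInForm_zero_of_mem_succ c (by rwa [weightedIdealW_one_eq_pow c hgenr])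
    have hsum := IsInForm.add c hy' hz'
    rw [hyz, add_zero] at hsum
    exact ⟨residue R a, (hsum.eq_inForm c hgen hdim h1).symm⟩

include hgen hdim in
/-- **Cutkosky's `τ(I) = 1` is the tree's `τ = 1`** for an ideal of order exactly `r ≥ 1`: the
directrix of `cl_r(I)` is the line spanned by `ℓ̄`. [cite: Cutkosky2009, §5 p. 17 l. 39–43] -/
theorem hironakaTauAt_eq_one_of_tauOne (hμ : 0 < μ) (hord : HasOrder J μ) (hτ : TauOne J μ) :
    hironakaTauAt c J μ = 1 := by
  have hgenr := span_range_eq_of_span_triple c hgen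
  obtain ⟨l, -, hall⟩ := exists_shape_of_tauOne c hgen hdim hτ
  refine le_antisymm ?_ (one_le_hironakaTauAt c hgenr hμ hord.1 hord.2)
  set ℓf : Module.Dual (ResidueField R) (Fin 3 → ResidueField R) :=
    ∑ i, l i • (LinearMap.proj i : Module.Dual (ResidueField R) (Fin 3 → ResidueField R)) with hℓf
  have hsub : (initialForms c J μ : Set (MvPolynomial (Fin 3) (ResidueField R))) ⊆
      linearFormsSubalgebra (ResidueField R) (ResidueField R ∙ ℓf) := by
    intro G hG
    obtain ⟨g, hgJ, rfl⟩ := (mem_initialForms_iff_exists_inForm c hgen hdim hord.1 G).mp hG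
    obtain ⟨a, ha⟩ := hall g hgJ
    rw [ha, ← linearFormPoly_sum_smul_proj, ← smul_eq_C_mul]
    refine Subalgebra.smul_mem _ (Subalgebra.pow_mem _ ?_ μ) a
    exact Algebra.subset_adjoin ⟨ℓf, Submodule.mem_span_singleton_self ℓf, rfl⟩
  refine (hironakaTau_le_finrank_of_subset (ResidueField R) hsub).trans ?_
  refine (finrank_span_le_card ({ℓf} : Set (Module.Dual (ResidueField R) (Fin 3 → ResidueField R)))).trans ?_
  simp

include hgen hdim in
/-- **Conversely, the tree's `τ = 1` gives Cutkosky's**: if the directrix of `cl_r(I)` is a line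
`k·ℓ̄`, lift `ℓ̄` to `ℓ = Σ uᵢ cᵢ ∈ 𝔪 ∖ 𝔪²`; then every `g ∈ I` is `≡ a_g ℓ^r (mod 𝔪^{r+1})`.
[cite: Cutkosky2009, §5 p. 17 l. 39–43] -/
theorem tauOne_of_hironakaTauAt_eq_one (hJμ : J ≤ maximalIdeal R ^ μ)
    (hτ : hironakaTauAt c J μ = 1) : TauOne J μ := by
  have hgenr := span_range_eq_of_span_triple c hgen
  have h1 : ∀ i, 0 < (fun _ : Fin 3 => (1 : ℕ)) i := fun _ => Nat.one_pos
  obtain ⟨ℓf, hℓ0, -, hall⟩ := exists_forall_initialForms_eq_of_hironakaTauAt_eq_one c hτ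
  set l : Fin 3 → ResidueField R := fun i => ℓf (Pi.single i 1) with hl
  have hLpoly : linearFormPoly (ResidueField R) ℓf = linForm l := linearFormPoly_eq_linForm _ ℓf
  -- lift the coefficients
  obtain ⟨u0, hu0⟩ := residue_surjective (R := R) (l 0)
  obtain ⟨u1, hu1⟩ := residue_surjective (R := R) (l 1)
  obtain ⟨u2, hu2⟩ := residue_surjective (R := R) (l 2)
  set u : Fin 3 → R := ![u0, u1, u2] with hu
  set ℓ : R := u 0 * c 0 + u 1 * c 1 + u 2 * c 2 with hℓdef
  have hin1 : IsInForm c (fun _ => 1) 1 ℓ (linForm l) := by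
    have := isInForm_linear c u
    have hP : C (residue R (u 0)) * X 0 + C (residue R (u 1)) * X 1 + C (residue R (u 2)) * X 2 =
        linForm l := by
      rw [linForm_three]
      simp only [hu, Matrix.cons_val_zero, Matrix.cons_val_one, Matrix.head_cons, Matrix.cons_val_two,
        Matrix.tail_cons, hu0, hu1, hu2]
    rwa [hP] at this
  have hℓm : ℓ ∈ maximalIdeal R := by
    refine Ideal.add_mem _ (Ideal.add_mem _ ?_ ?_) ?_ <;>
      exact Ideal.mul_mem_left _ _ (param_mem_maximalIdeal c hgen _)
  refine ⟨ℓ, hℓm, ?_, ?_⟩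
  · -- `ℓ ∉ 𝔪²` because `ℓ̄ ≠ 0`
    intro hℓ2
    apply hℓ0
    have hz : inForm c (fun _ => 1) 1 ℓ = 0 :=
      (inForm_eq_zero_iff c hgen hdim h1 hin1.mem).mpr (by rwa [weightedIdealW_one_eq_pow c hgenr])
    have hP0 : linForm l = 0 := by rw [hin1.eq_inForm c hgen hdim h1, hz]
    apply linearFormPolyₗ_injective (ResidueField R)
    rw [linearFormPolyₗ_apply, linearFormPolyₗ_apply, hLpoly, hP0, ← linearFormPolyₗ_apply, map_zero]
  · intro g hg
    have hG : inForm c (fun _ => 1) μ g ∈ initialForms c J μ :=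
      (mem_initialForms_iff_exists_inForm c hgen hdim hJμ _).mpr ⟨g, hg, rfl⟩
    obtain ⟨a, ha⟩ := hall _ hG
    rw [hLpoly] at ha
    obtain ⟨at', hat⟩ := residue_surjective (R := R) a
    have hpow : IsInForm c (fun _ => 1) μ (ℓ ^ μ) (linForm l ^ μ) := by
      simpa using isInForm_pow c hin1 μ
    have hy := IsInForm.smul c hpow at'
    rw [hat] at hy
    have hg1 : g ∈ weightedIdealW c (fun _ => 1) μ := by
      rw [weightedIdealW_one_eq_pow c hgenr]; exact hJμ hg
    have hgin : IsInForm c (fun _ => 1) μ g (C a * linForm l ^ μ) := by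
      rw [← ha]; exact isInForm_inForm c hgen hdim h1 hg1
    have hdiff := isInForm_sub c hgin hy
    rw [sub_self] at hdiff
    have hmem := mem_succ_of_isInForm_zero c hgenr h1 hdiff
    rw [weightedIdealW_one_eq_pow c hgenr] at hmem
    refine Submodule.mem_sup.mpr ⟨at' * ℓ ^ μ, Ideal.mem_span_singleton'.mpr ⟨at', rfl⟩, g - at' * ℓ ^ μ, hmem, ?_⟩
    ring

end Tau


/-! ## Good parameters and the approximate manifold `z = 0` -/
section Good

variable {R : Type u} [CommRing R] [IsRegularLocalRing R] (c : Fin 3 → R)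
  (hgen : Ideal.span {c 0, c 1, c 2} = maximalIdeal R) (hdim : ringKrullDim R = 3)
  {J : Ideal R} {μ : ℕ}

include hdim in
/-- **Good parameters give a monic leading form**: if `(z, x, y) = (c 0, c 1, c 2)` are good for `I`
("`b_{00r} ≠ 0` for all `g ∈ I` such that `ν_T(g) = r`", with `ν_T(I) = r`), then some `r`-leading
form of `I` has a `Z^r` term — the tree's `HasMonic c I r`. [cite: Cutkosky2009, §10.2 p. 28 l. 65–66] -/
theorem hasMonic_of_isGood (hJ : IsGood c J μ) : HasMonic c J μ := by
  classical
  obtain ⟨hpar, ⟨hJμ, hnot⟩, hgood⟩ := hJ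
  have hgen : Ideal.span {c 0, c 1, c 2} = maximalIdeal R := hpar
  have hgenr := span_range_eq_of_span_triple c hgen
  have h1 : ∀ i, 0 < (fun _ : Fin 3 => (1 : ℕ)) i := fun _ => Nat.one_pos
  obtain ⟨g, hgJ, hgμ⟩ := (SetLike.not_le_iff_exists.mp hnot)
  refine ⟨g, hgJ, fun hcoeff => ?_⟩
  have hg1 : g ∈ weightedIdealW c (fun _ => 1) μ := by
    rw [weightedIdealW_one_eq_pow c hgenr]; exact hJμ hgJ
  obtain ⟨F, hF, hFP, hrem⟩ := isInForm_inForm c hgen hdim h1 hg1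
  have hc0 : F.coeff (Finsupp.single 0 μ) ∈ maximalIdeal R := by
    rw [← residue_eq_zero_iff, ← coeff_map, hFP, hcoeff]
  -- `F(c) ∈ (x, y) + 𝔪^{r+1}`
  have hev : eval c F ∈ Ideal.span {c 1, c 2} ⊔ maximalIdeal R ^ (μ + 1) := by
    rw [F.as_sum, map_sum]
    refine Ideal.sum_mem _ fun m hm => ?_
    rw [eval_monomial_eq_monom3]
    by_cases hm0 : m = Finsupp.single 0 μ
    · subst hm0
      refine Ideal.mem_sup_right ?_
      have hmon : monom3 c (Finsupp.single (0 : Fin 3) μ) = c 0 ^ μ := by simp [monom3]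
      rw [hmon, pow_succ']
      exact Ideal.mul_mem_mul hc0 (Ideal.pow_mem_pow (param_mem_maximalIdeal c hgen 0) μ)
    · have hw : m 0 + m 1 + m 2 = μ := by
        have := hF (mem_support_iff.mp hm); rwa [weight_one_eq] at this
      have h12 : m 1 ≠ 0 ∨ m 2 ≠ 0 := by
        by_contra h
        push Not at h
        apply hm0
        ext i
        fin_cases i
        · simp; omega
        · simp [h.1]
        · simp [h.2]
      refine Ideal.mem_sup_left (Ideal.mul_mem_left _ _ ?_)
      rw [monom3]
      rcases h12 with h | h
      · exact Ideal.mul_mem_right _ _ (Ideal.mul_mem_left _ _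
          (Ideal.pow_mem_of_mem _ (Ideal.subset_span (by simp)) _ (Nat.pos_of_ne_zero h)))
      · exact Ideal.mul_mem_left _ _
          (Ideal.pow_mem_of_mem _ (Ideal.subset_span (by simp)) _ (Nat.pos_of_ne_zero h))
  have hrem' : g - eval c F ∈ maximalIdeal R ^ (μ + 1) := by
    rwa [weightedIdealW_one_eq_pow c hgenr] at hrem
  refine hgood g hgJ hgμ ?_
  have := Ideal.add_mem _ (Ideal.mem_sup_right hrem') hev
  rwa [sub_add_cancel] at this

include hgen hdim in
/-- **"`z = 0` is an approximate manifold of `I`" ⟺ `I ⊆ (z^r) + 𝔪^{r+1}`**: all `r`-leading forms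
of `I` lie in `k[Z]` (the tree's shape `LinShape c I r 0 0`) iff every `g ∈ I` is
`a_g z^r (mod 𝔪^{r+1})`. [cite: Cutkosky2009, §5 p. 17 l. 39–43] -/
theorem linShape_zero_zero_iff_le_span_pow_sup (hJμ : J ≤ maximalIdeal R ^ μ) :
    LinShape c J μ 0 0 ↔ J ≤ Ideal.span {c 0 ^ μ} ⊔ maximalIdeal R ^ (μ + 1) := by
  have hgenr := span_range_eq_of_span_triple c hgen
  have h1 : ∀ i, 0 < (fun _ : Fin 3 => (1 : ℕ)) i := fun _ => Nat.one_pos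
  constructor
  · intro h g hg
    obtain ⟨a, ha⟩ := h g hg
    rw [linShape_poly_zero_zero] at ha
    obtain ⟨at', hat⟩ := residue_surjective (R := R) a
    have hg1 : g ∈ weightedIdealW c (fun _ => 1) μ := by
      rw [weightedIdealW_one_eq_pow c hgenr]; exact hJμ hg
    have hgin : IsInForm c (fun _ => 1) μ g (C a * X 0 ^ μ) := by
      rw [← ha]; exact isInForm_inForm c hgen hdim h1 hg1
    have hy := IsInForm.smul c (isInForm_pow_zero c μ) at'
    rw [hat] at hy
    have hdiff := isInForm_sub c hgin hy
    rw [sub_self] at hdiff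
    have hmem := mem_succ_of_isInForm_zero c hgenr h1 hdiff
    rw [weightedIdealW_one_eq_pow c hgenr] at hmem
    refine Submodule.mem_sup.mpr ⟨at' * c 0 ^ μ, Ideal.mem_span_singleton'.mpr ⟨at', rfl⟩,
      g - at' * c 0 ^ μ, hmem, ?_⟩
    ring
  · intro h g hg
    obtain ⟨y, hy, z, hz, hyz⟩ := Submodule.mem_sup.mp (h hg)
    obtain ⟨a, rfl⟩ := Ideal.mem_span_singleton'.mp hy
    have hy' := IsInForm.smul c (isInForm_pow_zero c μ) a
    have hz' : IsInForm c (fun _ => 1) μ z 0 :=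
      isInForm_zero_of_mem_succ c (by rwa [weightedIdealW_one_eq_pow c hgenr])
    have hsum := IsInForm.add c hy' hz'
    rw [hyz, add_zero] at hsum
    refine ⟨residue R a, ?_⟩
    rw [linShape_poly_zero_zero]
    exact (hsum.eq_inForm c hgen hdim h1).symm

include hgen hdim in
/-- The same shape read on the set `cl_r(I)` of leading forms. [cite: Cutkosky2009, §5 p. 17 l. 39–43] -/
theorem linShape_zero_zero_iff_forall_initialForms (hJμ : J ≤ maximalIdeal R ^ μ) :
    LinShape c J μ 0 0 ↔ ∀ G ∈ initialForms c J μ, ∃ a : ResidueField R, G = C a * X 0 ^ μ := by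
  constructor
  · intro h G hG
    obtain ⟨g, hgJ, rfl⟩ := (mem_initialForms_iff_exists_inForm c hgen hdim hJμ G).mp hG
    obtain ⟨a, ha⟩ := h g hgJ
    exact ⟨a, by rw [ha, linShape_poly_zero_zero]⟩
  · intro h g hg
    obtain ⟨a, ha⟩ := h _ ((mem_initialForms_iff_exists_inForm c hgen hdim hJμ _).mpr ⟨g, hg, rfl⟩)
    exact ⟨a, by rw [ha, linShape_poly_zero_zero]⟩

include hgen hdim in
/-- **Approximate manifold `z = 0` ⟺ the polygon `Δ(I; x, y, z)` is adapted (`δ > 1`)**, for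
`I ⊆ 𝔪^r` with Newton points: all leading forms are multiples of `Z^r` iff no Newton point lies on
the face `S(1)` (scaled: `r! < deltaS`; the tree's `AdaptedSystems`).
[cite: Cutkosky2009, §10.1 p. 28 observation 2, §10.2 p. 29 l. 17–19] [cite: CossartJannsenSaito2020, (12.1)] -/
theorem linShape_zero_zero_iff_factorial_lt_deltaS (hJμ : J ≤ maximalIdeal R ^ μ)
    (hne : (pts c J μ).Nonempty) : LinShape c J μ 0 0 ↔ μ.factorial < deltaS c J μ := by
  rw [linShape_zero_zero_iff_forall_initialForms c hgen hdim hJμ]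
  exact ⟨lt_deltaS_of_forall_initialForms c hgen hdim hJμ hne,
    forall_initialForms_of_lt_deltaS c hgen hdim hJμ⟩

end Good

/-! ## Lemma 10.1: prepared corners -/
section Corners

variable {R : Type u} [CommRing R] [IsRegularLocalRing R] (c : Fin 3 → R)
  (hgen : Ideal.span {c 0, c 1, c 2} = maximalIdeal R) (hdim : ringKrullDim R = 3)
  {J : Ideal R} {μ : ℕ}

include hgen hdim in
/-- **Lemma 10.1 (⇐).** `ν_T(I) = r ≥ 1`, `τ(I) = 1` (the tree's `hironakaTauAt c I r = 1`), good
parameters (a monic leading form) and both corners `(1,0)`, `(0,1)` prepared ⇒ `z = 0` is an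
approximate manifold of `I`: all `r`-leading forms are multiples of `Z^r`.  Proof as printed: the
common linear form `cz + ax + by` has `c ≠ 0`; `a ≠ 0` would make `(1,0)` solvable with `η = −a/c`,
`b ≠ 0` would make `(0,1)` solvable. [cite: Cutkosky2009, Lemma 10.1 p. 29 l. 17–40] -/
theorem linShape_zero_zero_of_preparedCorners (hJμ : J ≤ maximalIdeal R ^ μ) (hμ : 0 < μ)
    (hτ : hironakaTauAt c J μ = 1) (hmon : HasMonic c J μ) (hX : ∀ η : ResidueField R, η ≠ 0 →
      ¬ IsSolvableAt c J (levelWeight μ μ.factorial 1 2) (μ.factorial * μ) μ (vexp 1 0) η)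
    (hY : ∀ η : ResidueField R, η ≠ 0 →
      ¬ IsSolvableAt c J (levelWeight μ μ.factorial 2 1) (μ.factorial * μ) μ (vexp 0 1) η) : LinShape c J μ 0 0 := by
  obtain ⟨b, cc, hshape⟩ := exists_linShape_of_hironakaTauAt_eq_one c hgen hdim hJμ hμ hτ hmon
  have hb : b = 0 := by
    by_contra hb
    exact hX b hb (isSolvableAt_tilt_two_of_forall_inForm c hgen hdim hJμ hshape)
  have hcc : cc = 0 := by
    by_contra hcc
    exact hY cc hcc (isSolvableAt_tilt_one_of_forall_inForm c hgen hdim hJμ hshape)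
  subst hb hcc
  exact hshape

include hgen hdim in
/-- **Lemma 10.1 (⇒), the `x`-corner.** If `z = 0` is an approximate manifold of `I` and some leading
form has a `Z^r` term, then `(1, 0)` is prepared: `{g}^{(1,0)} = a_g z^r` cannot equal
`b(z − ηx)^r` with `η ≠ 0` (evaluate at `z = η x`). [cite: Cutkosky2009, Lemma 10.1 p. 29 l. 40] -/
theorem preparedCornerX_of_linShape_zero_zero (hJμ : J ≤ maximalIdeal R ^ μ) (hμ : 0 < μ)
    (h : LinShape c J μ 0 0) (hmon : HasMonic c J μ) :
    ∀ η : ResidueField R, η ≠ 0 →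
      ¬ IsSolvableAt c J (levelWeight μ μ.factorial 1 2) (μ.factorial * μ) μ (vexp 1 0) η := by
  have hgenr := span_range_eq_of_span_triple c hgen
  have h1 : ∀ i, 0 < (fun _ : Fin 3 => (1 : ℕ)) i := fun _ => Nat.one_pos
  have hW : ∀ i, 0 < levelWeight μ μ.factorial 1 2 i :=
    levelWeight_pos (Nat.factorial_pos μ) Nat.one_pos (by norm_num)
  intro η hη hsolv
  obtain ⟨g₀, hg₀J, hg₀⟩ := hmon
  obtain ⟨a, ha⟩ := h g₀ hg₀J
  have ha0 : a ≠ 0 := by rw [← LinShape.coeff_single_zero c ha]; exact hg₀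
  have hg1 : g₀ ∈ weightedIdealW c (fun _ => 1) μ := by
    rw [weightedIdealW_one_eq_pow c hgenr]; exact hJμ hg₀J
  have hin := (isInForm_inForm c hgen hdim h1 hg1).tilt_two c
  rw [ha, xfree_two_linearPow] at hin
  obtain ⟨-, -, hsol⟩ := hsolv
  obtain ⟨a', ha'⟩ := hsol g₀ hg₀J hin.mem
  have heq := (hin.eq_inForm c hgen hdim hW).trans ha'
  rw [monomial_vexp_one_zero] at heq
  have hev := congrArg (MvPolynomial.eval (![-η, 1, 0] : Fin 3 → ResidueField R)) heq
  simp only [map_mul, map_pow, map_add, eval_C, eval_X, Matrix.cons_val_zero, Matrix.cons_val_one] at hev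
  rw [zero_mul, add_zero, mul_one, neg_add_cancel, zero_pow hμ.ne', mul_zero] at hev
  exact (mul_ne_zero ha0 (pow_ne_zero μ (neg_ne_zero.mpr hη))) hev

include hgen hdim in
/-- **Lemma 10.1 (⇒), the `y`-corner.** [cite: Cutkosky2009, Lemma 10.1 p. 29 l. 40] -/
theorem preparedCornerY_of_linShape_zero_zero (hJμ : J ≤ maximalIdeal R ^ μ) (hμ : 0 < μ)
    (h : LinShape c J μ 0 0) (hmon : HasMonic c J μ) :
    ∀ η : ResidueField R, η ≠ 0 →
      ¬ IsSolvableAt c J (levelWeight μ μ.factorial 2 1) (μ.factorial * μ) μ (vexp 0 1) η := by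
  have hgenr := span_range_eq_of_span_triple c hgen
  have h1 : ∀ i, 0 < (fun _ : Fin 3 => (1 : ℕ)) i := fun _ => Nat.one_pos
  have hW : ∀ i, 0 < levelWeight μ μ.factorial 2 1 i :=
    levelWeight_pos (Nat.factorial_pos μ) (by norm_num) Nat.one_pos
  intro η hη hsolv
  obtain ⟨g₀, hg₀J, hg₀⟩ := hmon
  obtain ⟨a, ha⟩ := h g₀ hg₀J
  have ha0 : a ≠ 0 := by rw [← LinShape.coeff_single_zero c ha]; exact hg₀
  have hg1 : g₀ ∈ weightedIdealW c (fun _ => 1) μ := by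
    rw [weightedIdealW_one_eq_pow c hgenr]; exact hJμ hg₀J
  have hin := (isInForm_inForm c hgen hdim h1 hg1).tilt_one c
  rw [ha, xfree_one_linearPow] at hin
  obtain ⟨-, -, hsol⟩ := hsolv
  obtain ⟨a', ha'⟩ := hsol g₀ hg₀J hin.mem
  have heq := (hin.eq_inForm c hgen hdim hW).trans ha'
  rw [monomial_vexp_zero_one] at heq
  have hev := congrArg (MvPolynomial.eval (![-η, 0, 1] : Fin 3 → ResidueField R)) heq
  simp only [map_mul, map_pow, map_add, eval_C, eval_X, Matrix.cons_val_zero, Matrix.head_cons,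
    Matrix.cons_val_two, Matrix.tail_cons] at hev
  rw [zero_mul, add_zero, mul_one, neg_add_cancel, zero_pow hμ.ne', mul_zero] at hev
  exact (mul_ne_zero ha0 (pow_ne_zero μ (neg_ne_zero.mpr hη))) hev

include hgen hdim in
/-- **Lemma 10.1** (verbatim shape): "Suppose that `ν_T(I) = r`, `τ(I) = 1`, and `(x, y, z)` are good
parameters of `I`.  Then `z = 0` is an approximate manifold of `I` if and only if the vertices `(0,1)`
and `(1,0)` are prepared on `|Δ(I; x, y, z)|`" — with `τ = 1` as `hironakaTauAt = 1` and goodness as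
a monic leading form. [cite: Cutkosky2009, Lemma 10.1 p. 29 l. 17–19] -/
theorem linShape_zero_zero_iff_preparedCorners (hJμ : J ≤ maximalIdeal R ^ μ) (hμ : 0 < μ)
    (hτ : hironakaTauAt c J μ = 1) (hmon : HasMonic c J μ) :
    LinShape c J μ 0 0 ↔
      (∀ η : ResidueField R, η ≠ 0 →
      ¬ IsSolvableAt c J (levelWeight μ μ.factorial 1 2) (μ.factorial * μ) μ (vexp 1 0) η) ∧
      (∀ η : ResidueField R, η ≠ 0 →
      ¬ IsSolvableAt c J (levelWeight μ μ.factorial 2 1) (μ.factorial * μ) μ (vexp 0 1) η) :=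
  ⟨fun h => ⟨preparedCornerX_of_linShape_zero_zero c hgen hdim hJμ hμ h hmon,
    preparedCornerY_of_linShape_zero_zero c hgen hdim hJμ hμ h hmon⟩,
    fun h => linShape_zero_zero_of_preparedCorners c hgen hdim hJμ hμ hτ hmon h.1 h.2⟩

include hgen hdim in
/-- **Consequence: the polygon is adapted.** Under the hypotheses of Lemma 10.1 with both corners
prepared, no Newton point of `Δ(I; x, y, z)` lies on the face `S(1)`: `δ > 1` (scaled `r! < deltaS`) —
the standing hypothesis of the tree's polygon-transport theorems. [cite: Cutkosky2009, Lemma 10.1 p. 29;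
Thm. 10.17 proof p. 34 l. 42–46] -/
theorem factorial_lt_deltaS_of_preparedCorners (hJμ : J ≤ maximalIdeal R ^ μ) (hμ : 0 < μ)
    (hne : (pts c J μ).Nonempty) (hτ : hironakaTauAt c J μ = 1) (hmon : HasMonic c J μ)
    (hX : ∀ η : ResidueField R, η ≠ 0 →
      ¬ IsSolvableAt c J (levelWeight μ μ.factorial 1 2) (μ.factorial * μ) μ (vexp 1 0) η)
    (hY : ∀ η : ResidueField R, η ≠ 0 →
      ¬ IsSolvableAt c J (levelWeight μ μ.factorial 2 1) (μ.factorial * μ) μ (vexp 0 1) η) : μ.factorial < deltaS c J μ :=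
  (linShape_zero_zero_iff_factorial_lt_deltaS c hgen hdim hJμ hne).mp
    (linShape_zero_zero_of_preparedCorners c hgen hdim hJμ hμ hτ hmon hX hY)

include hgen hdim in
/-- **Eq. (20) of the proof of Theorem 10.17: `α + β > 1`** (scaled: `r! < alphaS + betaS`) — "Lemma
10.1 implies `z = 0` is an approximate manifold of `I`.  Thus since `τ(I) = 1`, `α + β > 1`"; here for
(very) well prepared good parameters only the preparedness of the two corners is used.
[cite: Cutkosky2009, Thm. 10.17 proof p. 34 l. 42–46, eq. (20)] -/
theorem factorial_lt_alphaS_add_betaS_of_preparedCorners (hJμ : J ≤ maximalIdeal R ^ μ) (hμ : 0 < μ)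
    (hne : (pts c J μ).Nonempty) (hτ : hironakaTauAt c J μ = 1) (hmon : HasMonic c J μ)
    (hX : ∀ η : ResidueField R, η ≠ 0 →
      ¬ IsSolvableAt c J (levelWeight μ μ.factorial 1 2) (μ.factorial * μ) μ (vexp 1 0) η)
    (hY : ∀ η : ResidueField R, η ≠ 0 →
      ¬ IsSolvableAt c J (levelWeight μ μ.factorial 2 1) (μ.factorial * μ) μ (vexp 0 1) η) :
    μ.factorial < alphaS c J μ + betaS c J μ :=
  (factorial_lt_deltaS_of_preparedCorners c hgen hdim hJμ hμ hne hτ hmon hX hY).trans_le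
    (deltaS_le_alphaS_add_betaS hne)

include hdim in
/-- **Lemma 10.1 in the vocabulary of `CutkoskySurfaceOmegaSequence.lean`** (the typed hypotheses of
the named fact `Cutkosky2009_Thm10_18`): for an ideal `I` of order exactly `r ≥ 1` with `τ(I) = 1`
(`Cutkosky2009.TauOne`) and GOOD parameters `c = (z, x, y)` (`Cutkosky2009.IsGood`), `z = 0` is an
approximate manifold of `I` — `I ⊆ (z^r) + 𝔪^{r+1}` — iff the corners `(1,0)` and `(0,1)` are prepared.
[cite: Cutkosky2009, Lemma 10.1 p. 29 l. 17–19] -/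
theorem le_span_pow_sup_iff_preparedCorners (hμ : 0 < μ) (hgood : IsGood c J μ) (hτ : TauOne J μ) :
    J ≤ Ideal.span {c 0 ^ μ} ⊔ maximalIdeal R ^ (μ + 1) ↔
      (∀ η : ResidueField R, η ≠ 0 →
      ¬ IsSolvableAt c J (levelWeight μ μ.factorial 1 2) (μ.factorial * μ) μ (vexp 1 0) η) ∧
      (∀ η : ResidueField R, η ≠ 0 →
      ¬ IsSolvableAt c J (levelWeight μ μ.factorial 2 1) (μ.factorial * μ) μ (vexp 0 1) η) := by
  have hgen : Ideal.span {c 0, c 1, c 2} = maximalIdeal R := hgood.1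
  have hJμ : J ≤ maximalIdeal R ^ μ := hgood.2.1.1
  rw [← linShape_zero_zero_iff_le_span_pow_sup c hgen hdim hJμ]
  exact linShape_zero_zero_iff_preparedCorners c hgen hdim hJμ hμ
    (hironakaTauAt_eq_one_of_tauOne c hgen hdim hμ hgood.2.1 hτ) (hasMonic_of_isGood c hdim hgood)

include hdim in
/-- **Eq. (20) in the same vocabulary**: good parameters, `τ(I) = 1`, both corners prepared and a
non-empty polygon give `α + β > 1` (scaled by `L = r!`: `r! < alphaS + betaS`).
[cite: Cutkosky2009, Thm. 10.17 proof p. 34 l. 42–46, eq. (20)] -/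
theorem factorial_lt_alphaS_add_betaS_of_isGood (hμ : 0 < μ) (hgood : IsGood c J μ) (hτ : TauOne J μ)
    (hne : (pts c J μ).Nonempty) (hX : ∀ η : ResidueField R, η ≠ 0 →
      ¬ IsSolvableAt c J (levelWeight μ μ.factorial 1 2) (μ.factorial * μ) μ (vexp 1 0) η)
    (hY : ∀ η : ResidueField R, η ≠ 0 →
      ¬ IsSolvableAt c J (levelWeight μ μ.factorial 2 1) (μ.factorial * μ) μ (vexp 0 1) η) :
    μ.factorial < alphaS c J μ + betaS c J μ :=
  factorial_lt_alphaS_add_betaS_of_preparedCorners c hgood.1 hdim hgood.2.1.1 hμ hne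
    (hironakaTauAt_eq_one_of_tauOne c hgood.1 hdim hμ hgood.2.1 hτ) (hasMonic_of_isGood c hdim hgood) hX hY

end Corners


/-! ## Good parameters ⟺ "`b_{00r}(g) ≠ 0`" on the leading forms ⟺ (under `τ = 1`) one monic leading form -/
section GoodIff

variable {R : Type u} [CommRing R] [IsRegularLocalRing R] (c : Fin 3 → R)
  (hgen : Ideal.span {c 0, c 1, c 2} = maximalIdeal R) (hdim : ringKrullDim R = 3)
  {J : Ideal R} {μ : ℕ}

include hgen hdim in
/-- **`b_{00r}(g) ≠ 0` ⇒ `g ∉ (x, y) + 𝔪^{r+1}`**: if the `Z^r`-coefficient of the `r`-leading form of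
`g ∈ 𝔪^r` is non-zero then `Z^r` is an initial unit term of `g`, and an element of `(x, y) + 𝔪^{r+1}`
has none (read along the weight `(1, r+1, r+1)`, for which `(x, y) + 𝔪^{r+1} ⊆ F_{r+1}`).
[cite: Cutkosky2009, §10.2 p. 28 l. 65–66] [cite: CossartJannsenSaito2020, Def. 8.2] -/
theorem not_mem_span_sup_of_coeff_ne_zero {g : R} (hg : g ∈ maximalIdeal R ^ μ)
    (hcoeff : (inForm c (fun _ => 1) μ g).coeff (Finsupp.single 0 μ) ≠ 0) :
    g ∉ Ideal.span {c 1, c 2} ⊔ maximalIdeal R ^ (μ + 1) := by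
  have hgenr := span_range_eq_of_span_triple c hgen
  have h1 : ∀ i, 0 < (fun _ : Fin 3 => (1 : ℕ)) i := fun _ => Nat.one_pos
  have hg1 : g ∈ weightedIdealW c (fun _ => 1) μ := by rwa [weightedIdealW_one_eq_pow c hgenr]
  have hwt : Finsupp.weight (fun _ : Fin 3 => (1 : ℕ)) (Finsupp.single 0 μ) = μ := by
    rw [weight_one_eq]; simp
  have hinit : IsInitialTerm c (fun _ => 1) g (Finsupp.single 0 μ) :=
    (mem_support_inForm_iff c hgen hdim h1 hg1 hwt).mp (mem_support_iff.mpr hcoeff)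
  intro hmem
  -- the weight `w' = (1, μ+1, μ+1)`
  set w' : Fin 3 → ℕ := ![1, μ + 1, μ + 1] with hw'
  have hw'pos : ∀ i, 0 < w' i := by intro i; fin_cases i <;> simp [hw']
  have hle : Ideal.span {c 1, c 2} ⊔ maximalIdeal R ^ (μ + 1) ≤ weightedIdealW c w' (μ + 1) := by
    refine sup_le ?_ (pow_maximalIdeal_le_weightedIdealW c hgenr hw'pos _)
    rw [Ideal.span_le]
    rintro x hx
    simp only [Set.mem_insert_iff, Set.mem_singleton_iff] at hx
    rcases hx with rfl | rfl
    · have : monom3 c (Finsupp.single 1 1) = c 1 := by simp [monom3]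
      rw [← this]
      refine monomial_mem_weightedIdealW c w' ?_
      rw [Finsupp.weight_apply, Finsupp.sum_single_index (by simp)]; simp [hw']
    · have : monom3 c (Finsupp.single 2 1) = c 2 := by simp [monom3]
      rw [← this]
      refine monomial_mem_weightedIdealW c w' ?_
      rw [Finsupp.weight_apply, Finsupp.sum_single_index (by simp)]; simp [hw']
  have hbound := le_weight_of_isInitialTerm_of_mem c hgen hdim h1 hw'pos hinit (hle hmem)
  rw [Finsupp.weight_apply, Finsupp.sum_single_index (by simp)] at hbound
  simp [hw'] at hbound

include hgen hdim in
/-- **`b_{00r}(g) = 0` ⇒ `g ∈ (x, y) + 𝔪^{r+1}`** for `g ∈ 𝔪^r`: the remaining terms of a degree-`r`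
representative involve `x` or `y`, and a non-unit `Z^r`-coefficient contributes to `𝔪^{r+1}`.
[cite: Cutkosky2009, §10.2 p. 28 l. 65–66] -/
theorem mem_span_sup_of_coeff_eq_zero {g : R} (hg : g ∈ maximalIdeal R ^ μ)
    (hcoeff : (inForm c (fun _ => 1) μ g).coeff (Finsupp.single 0 μ) = 0) :
    g ∈ Ideal.span {c 1, c 2} ⊔ maximalIdeal R ^ (μ + 1) := by
  classical
  have hgenr := span_range_eq_of_span_triple c hgen
  have h1 : ∀ i, 0 < (fun _ : Fin 3 => (1 : ℕ)) i := fun _ => Nat.one_pos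
  have hg1 : g ∈ weightedIdealW c (fun _ => 1) μ := by rwa [weightedIdealW_one_eq_pow c hgenr]
  obtain ⟨F, hF, hFP, hrem⟩ := isInForm_inForm c hgen hdim h1 hg1
  have hc0 : F.coeff (Finsupp.single 0 μ) ∈ maximalIdeal R := by
    rw [← residue_eq_zero_iff, ← coeff_map, hFP, hcoeff]
  have hev : eval c F ∈ Ideal.span {c 1, c 2} ⊔ maximalIdeal R ^ (μ + 1) := by
    rw [F.as_sum, map_sum]
    refine Ideal.sum_mem _ fun m hm => ?_
    rw [eval_monomial_eq_monom3]
    by_cases hm0 : m = Finsupp.single 0 μ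
    · subst hm0
      refine Ideal.mem_sup_right ?_
      have hmon : monom3 c (Finsupp.single (0 : Fin 3) μ) = c 0 ^ μ := by simp [monom3]
      rw [hmon, pow_succ']
      exact Ideal.mul_mem_mul hc0 (Ideal.pow_mem_pow (param_mem_maximalIdeal c hgen 0) μ)
    · have hw : m 0 + m 1 + m 2 = μ := by
        have := hF (mem_support_iff.mp hm); rwa [weight_one_eq] at this
      have h12 : m 1 ≠ 0 ∨ m 2 ≠ 0 := by
        by_contra h
        push Not at h
        apply hm0
        ext i
        fin_cases i
        · simp; omega
        · simp [h.1]
        · simp [h.2]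
      refine Ideal.mem_sup_left (Ideal.mul_mem_left _ _ ?_)
      rw [monom3]
      rcases h12 with h | h
      · exact Ideal.mul_mem_right _ _ (Ideal.mul_mem_left _ _
          (Ideal.pow_mem_of_mem _ (Ideal.subset_span (by simp)) _ (Nat.pos_of_ne_zero h)))
      · exact Ideal.mul_mem_left _ _
          (Ideal.pow_mem_of_mem _ (Ideal.subset_span (by simp)) _ (Nat.pos_of_ne_zero h))
  have hrem' : g - eval c F ∈ maximalIdeal R ^ (μ + 1) := by
    rwa [weightedIdealW_one_eq_pow c hgenr] at hrem
  have := Ideal.add_mem _ (Ideal.mem_sup_right hrem') hev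
  rwa [sub_add_cancel] at this

include hdim in
/-- **Good parameters, as printed**: "`(x, y, z)` will be called good parameters for `I` if
`ν_T(I) = r` and `b_{00r} ≠ 0` for all `g ∈ I` such that `ν_T(g) = r`" — the expansion-free
`Cutkosky2009.IsGood` IS this condition on the `Z^r`-coefficients of the leading forms.
[cite: Cutkosky2009, §10.2 p. 28 l. 65–66] -/
theorem isGood_iff_forall_coeff_ne_zero :
    IsGood c J μ ↔ IsParams c ∧ HasOrder J μ ∧
      ∀ g ∈ J, g ∉ maximalIdeal R ^ (μ + 1) → (inForm c (fun _ => 1) μ g).coeff (Finsupp.single 0 μ) ≠ 0 := by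
  constructor
  · rintro ⟨hpar, hord, hgood⟩
    refine ⟨hpar, hord, fun g hgJ hgμ hcoeff => hgood g hgJ hgμ ?_⟩
    exact mem_span_sup_of_coeff_eq_zero c hpar hdim (hord.1 hgJ) hcoeff
  · rintro ⟨hpar, hord, hgood⟩
    exact ⟨hpar, hord, fun g hgJ hgμ =>
      not_mem_span_sup_of_coeff_ne_zero c hpar hdim (hord.1 hgJ) (hgood g hgJ hgμ)⟩

include hgen hdim in
/-- **A common shape makes the parameters good**: if all leading forms of `I` are
`a_g (Z + bX + cY)^r` (so `a_g ≠ 0` exactly when `ν_T(g) = r`) and `I` has order exactly `r`, then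
`(z, x, y)` are good parameters. [cite: Cutkosky2009, §10.2 p. 28 l. 65–66, p. 29 l. 20–24] -/
theorem isGood_of_linShape (hord : HasOrder J μ) {b cc : ResidueField R}
    (hshape : LinShape c J μ b cc) : IsGood c J μ := by
  have hgenr := span_range_eq_of_span_triple c hgen
  have h1 : ∀ i, 0 < (fun _ : Fin 3 => (1 : ℕ)) i := fun _ => Nat.one_pos
  refine (isGood_iff_forall_coeff_ne_zero c hdim).mpr ⟨hgen, hord, fun g hgJ hgμ => ?_⟩
  obtain ⟨a, ha⟩ := hshape g hgJ
  rw [LinShape.coeff_single_zero c ha]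
  intro ha0
  apply hgμ
  have hg1 : g ∈ weightedIdealW c (fun _ => 1) μ := by
    rw [weightedIdealW_one_eq_pow c hgenr]; exact hord.1 hgJ
  have hz : inForm c (fun _ => 1) μ g = 0 := by rw [ha, ha0, C_0, zero_mul]
  have := (inForm_eq_zero_iff c hgen hdim h1 hg1).mp hz
  rwa [weightedIdealW_one_eq_pow c hgenr] at this

include hgen hdim in
/-- **"Good parameters exist if `τ(I) = 1`"**, in the given parameters: when `τ(I) = 1` and `I` has
order exactly `r ≥ 1`, `(z, x, y)` are good as soon as ONE leading form has a `Z^r` term (the tree's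
`HasMonic`) — then all non-zero leading forms do. [cite: Cutkosky2009, §10.2 p. 28 l. 66] -/
theorem isGood_of_hasMonic (hμ : 0 < μ) (hord : HasOrder J μ) (hτ : hironakaTauAt c J μ = 1)
    (hmon : HasMonic c J μ) : IsGood c J μ := by
  obtain ⟨b, cc, hshape⟩ := exists_linShape_of_hironakaTauAt_eq_one c hgen hdim hord.1 hμ hτ hmon
  exact isGood_of_linShape c hgen hdim hord hshape

include hgen hdim in
/-- Under `τ(I) = 1` and order exactly `r ≥ 1`: good parameters ⟺ a monic leading form.
[cite: Cutkosky2009, §10.2 p. 28 l. 65–66] -/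
theorem isGood_iff_hasMonic (hμ : 0 < μ) (hord : HasOrder J μ) (hτ : hironakaTauAt c J μ = 1) :
    IsGood c J μ ↔ HasMonic c J μ :=
  ⟨fun h => hasMonic_of_isGood c hdim h, fun h => isGood_of_hasMonic c hgen hdim hμ hord hτ h⟩

end GoodIff

end Literature.AlgebraicGeometry.Resolution.Cutkosky2009
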